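import Summits.ValiantsHypothesis.ValiantsHypothesis.Theorems.LacunarySymmetroidMatrixDescartesCensusTropicalKLaw

/-!
# `MatrixDescartes` — census vocabulary, tropical side, part 4: the STATIC REDUCTION

HONEST FRAMING.  Helper of the crux `Summit.ValiantsHypothesis.ValiantsHypothesis.Theses.LacunarySymmetroid.MatrixDescartes`
(ledger item `stmt-ValiantsHypothesis-18050`; object-search cell `pub-symmetroid`, Conjecture-B ideation seat conjb-2,
2026-08-25), companion of `…CensusTropicalKLaw` (part 1).  It proves ONE elementary combinatorial reduction between two
row predicates and asserts nothing about `KPlusLogSqLaw`, `MatrixDescartes` or `VP ≠ VNP`.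

* `IsStatic ε` — every entry carries at most one present class: the design IS a linear parametric assignment instance
  (`cost(i,j) = v − θ·d_{class(i,j)}`) whose entry slopes take at most `K` values.
* `TropRootLawAtStatic m K B` — the tree row predicate `TropRootLawAt` with the extra hypothesis `IsStatic ε`
  (trivially implied by `TropRootLawAt m K B`: `tropRootLawAtStatic_of_tropRootLawAt`).
* `tropRootLawAt_of_static : TropRootLawAtStatic m K B → TropRootLawAt m K ((m·m·(K−1)+1)·(B+1) − 1)` — STATIC REDUCTION.
  Proof: per entry and chain index take the key-maximal present class (`key`, `key_injective`; a dominant term uses it at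
  each of its entries, `score_lt_of_dominant`); the potential `Σ_{entries} dRank(best class)` is monotone along the chain
  with at most `m²(K−1)+1` values, and on a block of constant potential the chain is a chain of ONE static design (delete the
  non-profile classes; weights unchanged, signs agree by `termSign_congr` / `termSign_restrict`, competitors shrink).
  Consequence: the candidate law `TropKPlusLogSqLaw` (TB) is equivalent to its static form — all super-polynomial content of
  TB is permutation change inside one linear parametric assignment instance with `K` slope classes (the `K`-slope-graded
  Birkhoff-shadow count, cf. `Literature/Computability/AlgebraicComplexity/BirkhoffShadow.lean`).
-/

set_option linter.dupNamespace false
set_option autoImplicit false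

namespace Summit.ValiantsHypothesis.ValiantsHypothesis.Theorems.LacunarySymmetroidMatrixDescartes.TropicalCensus

open Summit.ValiantsHypothesis.ValiantsHypothesis.Theorems.MatrixDescartes.Negative
open scoped BigOperators
open Finset

section Static

variable {m K : ℕ}

/-- a STATIC design: every entry carries at most one present class. -/
def IsStatic (ε : Fin m → Fin m → Fin K → ℤ) : Prop :=
  ∀ i j l l', ε i j l ≠ 0 → ε i j l' ≠ 0 → l = l'

/-- the tropical row law restricted to static designs (= signed breakpoints of linear parametric assignment
instances whose entry slopes take at most `K` values). -/
def TropRootLawAtStatic (m K B : ℕ) : Prop :=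
  ∀ (d : Fin K → ℕ) (v ε : Fin m → Fin m → Fin K → ℤ) (n : ℕ) (θ : Fin (n + 1) → ℤ)
    (p : Fin (n + 1) → Equiv.Perm (Fin m) × (Fin m → Fin K)),
    (∀ i j l, (ε i j l).natAbs ≤ 1) → IsStatic ε → StrictMono θ → (∀ k, IsDominant d v ε (θ k) (p k)) →
    (∀ k : Fin n, termSign ε (p k.castSucc) * termSign ε (p k.succ) < 0) → n ≤ B

/-- the static row law is a special case of the tropical row law `TropRootLawAt m K B`. -/
theorem tropRootLawAtStatic_of_tropRootLawAt {B : ℕ} (h : TropRootLawAt m K B) : TropRootLawAtStatic m K B :=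
  fun d v ε n θ p hε _ hθ hdom halt => h d v ε n θ p hε hθ hdom halt

/-- `dRank d` (the number of classes of strictly smaller exponent) is monotone in the exponent. -/
theorem dRank_mono (d : Fin K → ℕ) {l l' : Fin K} (h : d l ≤ d l') : dRank d l ≤ dRank d l' := by
  rcases h.lt_or_eq with h | h
  · exact (dRank_lt_of_lt d h).le
  · unfold dRank
    apply card_le_card
    intro x hx
    rw [mem_filter] at hx ⊢
    exact ⟨mem_univ _, by omega⟩

/-! ### one-entry swaps -/

/-- a present term stays present after replacing the class at one entry by a class present at that entry -/
theorem termSign_update_ne_zero' (ε : Fin m → Fin m → Fin K → ℤ) (σ : Equiv.Perm (Fin m))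
    (μ : Fin m → Fin K) (hμ : termSign ε (σ, μ) ≠ 0) (i : Fin m) (x : Fin K) (hx : ε (σ i) i x ≠ 0) :
    termSign ε (σ, Function.update μ i x) ≠ 0 := by
  unfold termSign at *
  dsimp only at *
  have hμ' := (mul_ne_zero_iff.mp hμ).2
  refine mul_ne_zero (mul_ne_zero_iff.mp hμ).1 ?_
  rw [prod_ne_zero_iff] at hμ' ⊢
  intro j _
  by_cases hji : j = i
  · subst hji
    rw [Function.update_self]
    exact hx
  · rw [Function.update_of_ne hji]
    exact hμ' j (mem_univ _)

/-- the class of a dominant term at an entry STRICTLY beats every other present class of that entry -/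
theorem score_lt_of_dominant (d : Fin K → ℕ) (v ε : Fin m → Fin m → Fin K → ℤ) (θ : ℤ)
    (σ : Equiv.Perm (Fin m)) (μ : Fin m → Fin K) (h : IsDominant d v ε θ (σ, μ)) (i : Fin m) (x : Fin K)
    (hx : ε (σ i) i x ≠ 0) (hne : x ≠ μ i) :
    θ * (d x : ℤ) - v (σ i) i x < θ * (d (μ i) : ℤ) - v (σ i) i (μ i) := by
  have hq : termSign ε (σ, Function.update μ i x) ≠ 0 := termSign_update_ne_zero' ε σ μ h.1 i x hx
  have hneq : (σ, Function.update μ i x) ≠ (σ, μ) := by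
    intro hh
    have := congrArg (fun q : Equiv.Perm (Fin m) × (Fin m → Fin K) => q.2 i) hh
    simp only [Function.update_self] at this
    exact hne this
  have h1 := h.2 _ hneq hq
  unfold tropWeight at h1
  simp only at h1
  rw [sum_update_arg (fun _ l => (d l : ℤ)) μ i x, sum_update_arg (fun j l => v (σ j) j l) μ i x] at h1
  nlinarith

/-- the sign of a present term only sees the classes it uses: restricting a design entrywise does not change it -/
theorem termSign_restrict (ε ε' : Fin m → Fin m → Fin K → ℤ) (hεε' : ∀ i j l, ε' i j l ≠ 0 → ε' i j l = ε i j l)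
    (q : Equiv.Perm (Fin m) × (Fin m → Fin K)) (hq : termSign ε' q ≠ 0) : termSign ε' q = termSign ε q := by
  unfold termSign at *
  have hq' := (mul_ne_zero_iff.mp hq).2
  rw [prod_ne_zero_iff] at hq'
  congr 1
  exact prod_congr rfl fun j _ => hεε' _ _ _ (hq' j (mem_univ _))


/-- signs agree when the two designs agree on the entries a term uses -/
theorem termSign_congr (ε ε' : Fin m → Fin m → Fin K → ℤ) (q : Equiv.Perm (Fin m) × (Fin m → Fin K))
    (h : ∀ i, ε' (q.1 i) i (q.2 i) = ε (q.1 i) i (q.2 i)) : termSign ε' q = termSign ε q := by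
  unfold termSign
  congr 1
  exact prod_congr rfl fun j _ => h j

/-- a present term uses present classes -/
theorem present_of_termSign_ne_zero (ε : Fin m → Fin m → Fin K → ℤ) (q : Equiv.Perm (Fin m) × (Fin m → Fin K))
    (hq : termSign ε q ≠ 0) (i : Fin m) : ε (q.1 i) i (q.2 i) ≠ 0 := by
  unfold termSign at hq
  have hq' := (mul_ne_zero_iff.mp hq).2
  rw [prod_ne_zero_iff] at hq'
  exact hq' i (mem_univ _)

/-! ### the tie-broken best class of an entry -/

/-- comparison key of class `l` at entry `(i,j)` and parameter `θ`: `(K+1)·(θ·d l − v i j l) − l`; injective in `l`. -/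
def key (d : Fin K → ℕ) (v : Fin m → Fin m → Fin K → ℤ) (θ : ℤ) (i j : Fin m) (l : Fin K) : ℤ :=
  ((K : ℤ) + 1) * (θ * (d l : ℤ) - v i j l) - (l : ℕ)

/-- the comparison key `key d v θ i j` is injective in the class. -/
theorem key_injective (d : Fin K → ℕ) (v : Fin m → Fin m → Fin K → ℤ) (θ : ℤ) (i j : Fin m) {l l' : Fin K}
    (h : key d v θ i j l = key d v θ i j l') : l = l' := by
  unfold key at h
  have hl : ((l : ℕ) : ℤ) < K := by exact_mod_cast l.isLt
  have hl' : ((l' : ℕ) : ℤ) < K := by exact_mod_cast l'.isLt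
  have h0 : (0 : ℤ) ≤ ((l : ℕ) : ℤ) := by positivity
  have h0' : (0 : ℤ) ≤ ((l' : ℕ) : ℤ) := by positivity
  set s := θ * (d l : ℤ) - v i j l with hs
  set s' := θ * (d l' : ℤ) - v i j l' with hs'
  have e : ((K : ℤ) + 1) * (s - s') = ((l : ℕ) : ℤ) - ((l' : ℕ) : ℤ) := by linarith
  have hss' : s - s' = 0 := by
    rcases lt_trichotomy (s - s') 0 with hlt | heq | hgt
    · exfalso
      have : ((K : ℤ) + 1) * (s - s') ≤ -(((K : ℤ) + 1)) := by nlinarith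
      linarith
    · exact heq
    · exfalso
      have : ((K : ℤ) + 1) * (s - s') ≥ ((K : ℤ) + 1) := by nlinarith
      linarith
  have : ((l : ℕ) : ℤ) = ((l' : ℕ) : ℤ) := by rw [hss', mul_zero] at e; linarith
  exact Fin.ext (by exact_mod_cast this)

set_option maxHeartbeats 800000 in
/-- **STATIC REDUCTION.**  `TropRootLawAtStatic m K B → TropRootLawAt m K ((m·m·(K−1)+1)·(B+1) − 1)`. -/
theorem tropRootLawAt_of_static {B : ℕ} (h : TropRootLawAtStatic m K B) :
    TropRootLawAt m K ((m * m * (K - 1) + 1) * (B + 1) - 1) := by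
  intro d v ε n θ p hε hθ hdom halt
  rcases Nat.eq_zero_or_pos K with hK | hK
  · subst hK
    have hn : n ≤ B := h d v ε n θ p hε (fun i j l => l.elim0) hθ hdom halt
    have e : (m * m * (0 - 1) + 1) * (B + 1) - 1 = B := by simp
    omega
  -- a junk class for dead entries
  set l₀ : Fin K := ⟨0, hK⟩ with hl₀
  -- present classes of an entry
  obtain ⟨P, hmemP⟩ : ∃ P : Fin m → Fin m → Finset (Fin K), ∀ i j l, l ∈ P i j ↔ ε i j l ≠ 0 :=
    ⟨fun i j => univ.filter (fun l => ε i j l ≠ 0), fun i j l => by simp⟩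
  -- the best class Λ k i j (key-maximal among present classes; junk on dead entries)
  have hex : ∀ (k : Fin (n + 1)) (i j : Fin m), ∃ l : Fin K,
      ((P i j).Nonempty → (l ∈ P i j ∧ ∀ l' ∈ P i j, key d v (θ k) i j l' ≤ key d v (θ k) i j l)) ∧
      (¬ (P i j).Nonempty → l = l₀) := by
    intro k i j
    by_cases hne : (P i j).Nonempty
    · obtain ⟨l, hl, hmax⟩ := exists_max_image (P i j) (key d v (θ k) i j) hne
      exact ⟨l, fun _ => ⟨hl, hmax⟩, fun hh => absurd hne hh⟩
    · exact ⟨l₀, fun hh => absurd hh hne, fun _ => rfl⟩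
  choose Λ hΛ using hex
  -- F1: a dominant term uses the best class at each of its entries
  have hF1 : ∀ (k : Fin (n + 1)) (i : Fin m), (p k).2 i = Λ k ((p k).1 i) i := by
    intro k i
    have hpres : ε ((p k).1 i) i ((p k).2 i) ≠ 0 := present_of_termSign_ne_zero ε (p k) (hdom k).1 i
    have hne : (P ((p k).1 i) i).Nonempty := ⟨(p k).2 i, (hmemP _ _ _).mpr hpres⟩
    obtain ⟨hΛmem, hΛmax⟩ := (hΛ k ((p k).1 i) i).1 hne
    by_contra hcon
    have hΛpres : ε ((p k).1 i) i (Λ k ((p k).1 i) i) ≠ 0 := (hmemP _ _ _).mp hΛmem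
    have hdk : IsDominant d v ε (θ k) ((p k).1, (p k).2) := hdom k
    have hs := score_lt_of_dominant d v ε (θ k) (p k).1 (p k).2 hdk i (Λ k ((p k).1 i) i) hΛpres
      (fun hh => hcon hh.symm)
    have hm := hΛmax ((p k).2 i) ((hmemP _ _ _).mpr hpres)
    unfold key at hm
    have hl : (((p k).2 i : ℕ) : ℤ) < K := by exact_mod_cast ((p k).2 i).isLt
    have h0 : (0 : ℤ) ≤ ((Λ k ((p k).1 i) i : ℕ) : ℤ) := by positivity
    have hint : θ k * (d (Λ k ((p k).1 i) i) : ℤ) - v ((p k).1 i) i (Λ k ((p k).1 i) i) + 1 ≤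
        θ k * (d ((p k).2 i) : ℤ) - v ((p k).1 i) i ((p k).2 i) := hs
    nlinarith
  -- F2: along the chain the best class of a live entry moves to weakly larger exponents, strictly when it changes
  have hF2 : ∀ (k k' : Fin (n + 1)), k < k' → ∀ i j, d (Λ k i j) ≤ d (Λ k' i j) ∧
      (Λ k i j ≠ Λ k' i j → d (Λ k i j) < d (Λ k' i j)) := by
    intro k k' hkk' i j
    by_cases hne : (P i j).Nonempty
    · obtain ⟨h1mem, h1max⟩ := (hΛ k i j).1 hne
      obtain ⟨h2mem, h2max⟩ := (hΛ k' i j).1 hne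
      suffices hsuff : Λ k i j ≠ Λ k' i j → d (Λ k i j) < d (Λ k' i j) by
        refine ⟨?_, hsuff⟩
        by_cases hq : Λ k i j = Λ k' i j
        · rw [hq]
        · exact (hsuff hq).le
      intro hneq
      have ha : key d v (θ k) i j (Λ k' i j) < key d v (θ k) i j (Λ k i j) :=
        lt_of_le_of_ne (h1max _ h2mem) (fun hh => hneq (key_injective d v (θ k) i j hh).symm)
      have hb : key d v (θ k') i j (Λ k i j) < key d v (θ k') i j (Λ k' i j) :=
        lt_of_le_of_ne (h2max _ h1mem) (fun hh => hneq (key_injective d v (θ k') i j hh))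
      unfold key at ha hb
      have hθkk' : θ k < θ k' := hθ hkk'
      have hKpos : (0 : ℤ) < (K : ℤ) + 1 := by positivity
      set D := (d (Λ k' i j) : ℤ) - (d (Λ k i j) : ℤ) with hD
      have hsum : ((K : ℤ) + 1) * ((θ k' - θ k) * D) > 0 := by nlinarith
      have hD' : (θ k' - θ k) * D > 0 := by
        by_contra hcon
        push Not at hcon
        have := mul_nonpos_of_nonneg_of_nonpos hKpos.le hcon
        linarith
      have hDpos : D > 0 := by
        by_contra hcon
        push Not at hcon
        have := mul_nonpos_of_nonneg_of_nonpos (by linarith : (0 : ℤ) ≤ θ k' - θ k) hcon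
        linarith
      exact_mod_cast (sub_pos.mp hDpos)
    · rw [(hΛ k i j).2 hne, (hΛ k' i j).2 hne]
      exact ⟨le_rfl, fun hh => absurd rfl hh⟩
  -- the potential
  set Φ : Fin (n + 1) → ℕ := fun k => ∑ c : Fin m × Fin m, dRank d (Λ k c.1 c.2) with hΦ
  have hΦle : ∀ k, Φ k ≤ m * m * (K - 1) := by
    intro k
    calc Φ k = ∑ c : Fin m × Fin m, dRank d (Λ k c.1 c.2) := rfl
      _ ≤ ∑ _c : Fin m × Fin m, (K - 1) := sum_le_sum fun c _ => dRank_le d _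
      _ = m * m * (K - 1) := by
        rw [sum_const, card_univ, Fintype.card_prod, Fintype.card_fin, smul_eq_mul]
  have hΦmono : ∀ k k' : Fin (n + 1), k ≤ k' → Φ k ≤ Φ k' := by
    intro k k' hkk'
    rcases hkk'.lt_or_eq with hlt | heq
    · exact sum_le_sum fun c _ => dRank_mono d (hF2 k k' hlt c.1 c.2).1
    · rw [heq]
  have hΦeq : ∀ k k' : Fin (n + 1), k < k' → Φ k = Φ k' → ∀ i j, Λ k i j = Λ k' i j := by
    intro k k' hlt heq i j
    by_contra hne
    have hstrict : dRank d (Λ k i j) < dRank d (Λ k' i j) := dRank_lt_of_lt d ((hF2 k k' hlt i j).2 hne)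
    have : Φ k < Φ k' :=
      sum_lt_sum (fun c _ => dRank_mono d (hF2 k k' hlt c.1 c.2).1) ⟨(i, j), mem_univ _, hstrict⟩
    omega
  -- a block of constant potential is a chain of ONE static design, hence short
  have hblock : ∀ k₁ k₂ : Fin (n + 1), k₁ ≤ k₂ → Φ k₁ = Φ k₂ → (k₂ : ℕ) - k₁ ≤ B := by
    intro k₁ k₂ hk hΦk
    -- constancy of the profile on the block
    have hconst : ∀ k : Fin (n + 1), k₁ ≤ k → k ≤ k₂ → ∀ i j, Λ k i j = Λ k₁ i j := by
      intro k ha hb i j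
      rcases ha.lt_or_eq with hlt | heq
      · have h1 := hΦmono k₁ k ha
        have h2 := hΦmono k k₂ hb
        exact (hΦeq k₁ k hlt (by omega) i j).symm
      · rw [heq]
    -- the static design of the block
    obtain ⟨ε', hε'def⟩ : ∃ ε' : Fin m → Fin m → Fin K → ℤ,
        ∀ i j l, ε' i j l = if l = Λ k₁ i j then ε i j l else 0 := ⟨_, fun _ _ _ => rfl⟩
    have hε'pos : ∀ i j l, l = Λ k₁ i j → ε' i j l = ε i j l := by
      intro i j l hh; rw [hε'def, if_pos hh]
    have hε'neg : ∀ i j l, l ≠ Λ k₁ i j → ε' i j l = 0 := by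
      intro i j l hh; rw [hε'def, if_neg hh]
    have hε'res : ∀ i j l, ε' i j l ≠ 0 → ε' i j l = ε i j l := by
      intro i j l hl
      by_cases hh : l = Λ k₁ i j
      · exact hε'pos i j l hh
      · exact absurd (hε'neg i j l hh) hl
    have hε'1 : ∀ i j l, (ε' i j l).natAbs ≤ 1 := by
      intro i j l
      by_cases hh : l = Λ k₁ i j
      · rw [hε'pos i j l hh]; exact hε i j l
      · rw [hε'neg i j l hh]; simp
    have hε'static : IsStatic ε' := by
      intro i j l l' h1 h2
      by_cases e1 : l = Λ k₁ i j
      · by_cases e2 : l' = Λ k₁ i j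
        · exact e1.trans e2.symm
        · exact absurd (hε'neg i j l' e2) h2
      · exact absurd (hε'neg i j l e1) h1
    -- the sub-chain
    set N : ℕ := (k₂ : ℕ) - k₁ with hN
    have hidx : ∀ t : Fin (N + 1), (k₁ : ℕ) + t < n + 1 := by
      intro t; have := t.isLt; have := k₂.isLt; omega
    obtain ⟨ι, hι⟩ : ∃ ι : Fin (N + 1) → Fin (n + 1), ∀ t, ((ι t : Fin (n + 1)) : ℕ) = (k₁ : ℕ) + t :=
      ⟨fun t => ⟨(k₁ : ℕ) + t, hidx t⟩, fun _ => rfl⟩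
    have hιlo : ∀ t, k₁ ≤ ι t := by intro t; rw [Fin.le_iff_val_le_val, hι]; omega
    have hιhi : ∀ t, ι t ≤ k₂ := by
      intro t; rw [Fin.le_iff_val_le_val, hι]; have := t.isLt; omega
    have hsign : ∀ t, termSign ε' (p (ι t)) = termSign ε (p (ι t)) := by
      intro t
      apply termSign_congr
      intro i
      have h1 := hF1 (ι t) i
      have h2 := hconst (ι t) (hιlo t) (hιhi t) ((p (ι t)).1 i) i
      exact hε'pos _ _ _ (h1.trans h2)
    have hθ' : StrictMono (fun t => θ (ι t)) := by
      intro s t hst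
      apply hθ
      rw [Fin.lt_def] at hst ⊢
      rw [hι, hι]
      omega
    have hdom' : ∀ t, IsDominant d v ε' (θ (ι t)) (p (ι t)) := by
      intro t
      refine ⟨?_, ?_⟩
      · rw [hsign t]; exact (hdom (ι t)).1
      · intro q hq hqs
        have hqs' : termSign ε q ≠ 0 := by rw [← termSign_restrict ε ε' hε'res q hqs]; exact hqs
        exact (hdom (ι t)).2 q hq hqs'
    have halt' : ∀ t : Fin N, termSign ε' (p (ι t.castSucc)) * termSign ε' (p (ι t.succ)) < 0 := by
      intro t
      rw [hsign, hsign]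
      have ht : (k₁ : ℕ) + t < n := by have := t.isLt; have := k₂.isLt; omega
      have e1 : ι t.castSucc = (⟨(k₁ : ℕ) + t, ht⟩ : Fin n).castSucc := by
        apply Fin.ext; rw [hι]; simp
      have e2 : ι t.succ = (⟨(k₁ : ℕ) + t, ht⟩ : Fin n).succ := by
        apply Fin.ext; rw [hι]; simp; omega
      rw [e1, e2]
      exact halt ⟨(k₁ : ℕ) + t, ht⟩
    exact h d v ε' N (fun t => θ (ι t)) (fun t => p (ι t)) hε'1 hε'static hθ' hdom' halt'
  -- counting: `n + 1` indices, at most `m²(K−1)+1` potential values, each fibre an interval of length ≤ B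
  have hfib : ∀ φ ∈ (univ : Finset (Fin (n + 1))).image Φ,
      ((univ : Finset (Fin (n + 1))).filter (fun k => Φ k = φ)).card ≤ B + 1 := by
    intro φ hφ
    set S := (univ : Finset (Fin (n + 1))).filter (fun k => Φ k = φ) with hS
    have hSne : S.Nonempty := by
      obtain ⟨k, _, hk⟩ := mem_image.mp hφ
      exact ⟨k, by simp [hS, hk]⟩
    have hmin := min'_mem S hSne
    have hmax := max'_mem S hSne
    have hΦmin : Φ (S.min' hSne) = φ := by simpa [hS] using hmin
    have hΦmax : Φ (S.max' hSne) = φ := by simpa [hS] using hmax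
    have hle : S.min' hSne ≤ S.max' hSne := min'_le S _ hmax
    have hB := hblock _ _ hle (hΦmin.trans hΦmax.symm)
    have hsub : S ⊆ Icc (S.min' hSne) (S.max' hSne) := by
      intro k hk
      rw [mem_Icc]
      exact ⟨min'_le S k hk, le_max' S k hk⟩
    calc S.card ≤ (Icc (S.min' hSne) (S.max' hSne)).card := card_le_card hsub
      _ = (S.max' hSne : ℕ) + 1 - S.min' hSne := Fin.card_Icc _ _
      _ ≤ B + 1 := by omega
  have himg : ((univ : Finset (Fin (n + 1))).image Φ).card ≤ m * m * (K - 1) + 1 := by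
    have hsub : (univ : Finset (Fin (n + 1))).image Φ ⊆ range (m * m * (K - 1) + 1) := by
      intro φ hφ
      obtain ⟨k, _, hk⟩ := mem_image.mp hφ
      rw [mem_range, ← hk]
      exact Nat.lt_succ_of_le (hΦle k)
    calc ((univ : Finset (Fin (n + 1))).image Φ).card ≤ (range (m * m * (K - 1) + 1)).card := card_le_card hsub
      _ = m * m * (K - 1) + 1 := card_range _
  have hcount : n + 1 ≤ (m * m * (K - 1) + 1) * (B + 1) := by
    calc n + 1 = (univ : Finset (Fin (n + 1))).card := by simp
      _ = ∑ φ ∈ (univ : Finset (Fin (n + 1))).image Φ,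
            ((univ : Finset (Fin (n + 1))).filter (fun k => Φ k = φ)).card :=
          card_eq_sum_card_fiberwise fun k hk => mem_image_of_mem Φ hk
      _ ≤ ∑ _φ ∈ (univ : Finset (Fin (n + 1))).image Φ, (B + 1) := sum_le_sum hfib
      _ = ((univ : Finset (Fin (n + 1))).image Φ).card * (B + 1) := by rw [sum_const, smul_eq_mul]
      _ ≤ (m * m * (K - 1) + 1) * (B + 1) := Nat.mul_le_mul_right _ himg
  omega

end Static

end Summit.ValiantsHypothesis.ValiantsHypothesis.Theorems.LacunarySymmetroidMatrixDescartes.TropicalCensus
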